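import Summits.CriticalPhenomena.PercolationContinuityZ3.Theorems.Transplant.FKConnectivityAllQExchangeFar
import Summits.CriticalPhenomena.PercolationContinuityZ3.Theorems.Transplant.FKConnectivityAllQExchangeOneLe
import HarnessLib

/-!
# Connectivity correlation inequalities for `φ_{w,q}` — the FAR and STAR exchange inequalities HOLD for every `q ≥ 1`

Support file (`--supports stmt-CriticalPhenomena-4575`), FK sub-lane `prim-bschramm-fk-1` (gen 8); builds on p205010 (kernel theorem,
internal audit signed; external expert review pending).  No definitions, no named facts, no sorries; standard axioms.

The proof of `exchangeAdjOn_of_one_le` (`…ExchangeOneLe.lean`) does not use the position of the second pair: for `q ≥ 1` the exchange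
inequality `exchIneq w q x z g 𝒰` holds for EVERY pair `g` (positive correlation of two edge events + monotonicity in `𝐩`).  Hence the
nodes `ExchangeFarFKPos` and `ExchangeStarFKPos` of `…ExchangeFar.lean` are theorems on `[1, ∞)`.  For `q < 1`: STAR is provable on
paper (product situation); FAR is census-clean for `q ≥ 1/1000` on `≤ 6` vertices but its arboreal (`q ↓ 0`) limit has ONE violation
among 3,450 random weighted-forest instances on `≤ 7` vertices (kit j122543; bschramm/FROM-fk-1-g8-EXCHANGE.md §8) — so FAR, like K₀ at
the root, is expected to fail for small enough `q` on some 7-vertex graph; MM itself is clean in every census.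
[cite: Grimmett2006, Thm. (3.8) (p. 39); Thm. (3.21) (p. 43)]
-/

noncomputable section

namespace Summit.CriticalPhenomena.PercolationContinuityZ3.Theorems

namespace FK

open MeasureTheory Set Literature.Probability.LatticeModels Literature.Probability.Percolation
open scoped Classical

variable {V : Type*} [Fintype V]

/-- **For `q ≥ 1` the exchange inequality holds for every second pair `g`.** [cite: Grimmett2006, Thm. (3.8) (p. 39); Thm. (3.21) (p. 43)] -/
theorem exchIneq_of_one_le {q : ℝ} (hq : 1 ≤ q) (w : Sym2 V → unitInterval) (x z : V) (g : Sym2 V) (𝒰 : Set (Set V))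
    (h𝒰 : IsUpperSet 𝒰) : exchIneq w q x z g 𝒰 := by
  induction g using Sym2.ind with
  | _ v b =>
    unfold exchIneq
    -- `exchangeAdjOn_of_one_le` proves the inequality for `g = s(v,b)` without using its reachability hypothesis; we re-derive it
    -- through the `ExchangeAdjOn` statement at a vector where the hypothesis is vacuous is not possible, so we repeat the argument.
    have hA := isUpperSet_clusterIn x h𝒰
    have mono : ∀ c : unitInterval,
        (rcMeasureW (Function.update (Function.update w s(x, z) 0) s(v, b) c) q ∅).real (clusterIn x 𝒰) ≤
          (rcMeasureW (Function.update (Function.update w s(x, z) 1) s(v, b) c) q ∅).real (clusterIn x 𝒰) := by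
      intro c
      refine rcMeasureW_real_mono_weights (fun e => ?_) hq ∅ hA
      by_cases h1 : e = s(v, b)
      · subst h1; simp
      · rw [Function.update_of_ne h1, Function.update_of_ne h1]
        by_cases h2 : e = s(x, z)
        · subst h2; simp
        · rw [Function.update_of_ne h2, Function.update_of_ne h2]
    have monog : ∀ a : unitInterval,
        (rcMeasureW (Function.update (Function.update w s(x, z) a) s(v, b) 0) q ∅).real (clusterIn x 𝒰) ≤
          (rcMeasureW (Function.update (Function.update w s(x, z) a) s(v, b) 1) q ∅).real (clusterIn x 𝒰) := by
      intro a
      refine rcMeasureW_real_mono_weights (fun e => ?_) hq ∅ hA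
      by_cases h1 : e = s(v, b)
      · subst h1; simp
      · rw [Function.update_of_ne h1, Function.update_of_ne h1]
    have m1 := mono 1
    have m0 := mono 0
    have mg1 := monog 1
    have hq0 : 0 < q := one_pos.trans_le hq
    have hZ11 := (rcPartitionFunctionW_pos (Function.update (Function.update w s(x, z) 1) s(v, b) 1) hq0 (∅ : Set V)).le
    have hZ00 := (rcPartitionFunctionW_pos (Function.update (Function.update w s(x, z) 0) s(v, b) 0) hq0 (∅ : Set V)).le
    have hZ10 := (rcPartitionFunctionW_pos (Function.update (Function.update w s(x, z) 1) s(v, b) 0) hq0 (∅ : Set V)).le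
    have hZ01 := (rcPartitionFunctionW_pos (Function.update (Function.update w s(x, z) 0) s(v, b) 1) hq0 (∅ : Set V)).le
    by_cases hfg : s(x, z) = s(v, b)
    · rw [← hfg]
      simp only [Function.update_idem]
      apply le_of_eq; ring
    have hZ := partition_products_le_of_one_le w hq hfg
    by_cases hs : (rcMeasureW (Function.update (Function.update w s(x, z) 0) s(v, b) 1) q ∅).real (clusterIn x 𝒰) ≤
        (rcMeasureW (Function.update (Function.update w s(x, z) 1) s(v, b) 0) q ∅).real (clusterIn x 𝒰)
    · have l : rcPartitionFunctionW (Function.update (Function.update w s(x, z) 1) s(v, b) 0) q ∅ *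
          rcPartitionFunctionW (Function.update (Function.update w s(x, z) 0) s(v, b) 1) q ∅ *
          ((rcMeasureW (Function.update (Function.update w s(x, z) 0) s(v, b) 1) q ∅).real (clusterIn x 𝒰) -
            (rcMeasureW (Function.update (Function.update w s(x, z) 1) s(v, b) 0) q ∅).real (clusterIn x 𝒰)) ≤ 0 :=
        mul_nonpos_of_nonneg_of_nonpos (mul_nonneg hZ10 hZ01) (sub_nonpos.2 hs)
      have r : 0 ≤ rcPartitionFunctionW (Function.update (Function.update w s(x, z) 1) s(v, b) 1) q ∅ *
          rcPartitionFunctionW (Function.update (Function.update w s(x, z) 0) s(v, b) 0) q ∅ *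
          ((rcMeasureW (Function.update (Function.update w s(x, z) 1) s(v, b) 1) q ∅).real (clusterIn x 𝒰) -
            (rcMeasureW (Function.update (Function.update w s(x, z) 0) s(v, b) 0) q ∅).real (clusterIn x 𝒰)) :=
        mul_nonneg (mul_nonneg hZ11 hZ00) (by linarith [m0, mg1])
      linarith
    · push Not at hs
      have d : 0 ≤ (rcMeasureW (Function.update (Function.update w s(x, z) 0) s(v, b) 1) q ∅).real (clusterIn x 𝒰) -
          (rcMeasureW (Function.update (Function.update w s(x, z) 1) s(v, b) 0) q ∅).real (clusterIn x 𝒰) := by linarith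
      calc _ ≤ rcPartitionFunctionW (Function.update (Function.update w s(x, z) 1) s(v, b) 1) q ∅ *
            rcPartitionFunctionW (Function.update (Function.update w s(x, z) 0) s(v, b) 0) q ∅ *
            ((rcMeasureW (Function.update (Function.update w s(x, z) 0) s(v, b) 1) q ∅).real (clusterIn x 𝒰) -
              (rcMeasureW (Function.update (Function.update w s(x, z) 1) s(v, b) 0) q ∅).real (clusterIn x 𝒰)) :=
            mul_le_mul_of_nonneg_right hZ d
        _ ≤ _ := mul_le_mul_of_nonneg_left (by linarith [m0, m1, mg1]) (mul_nonneg hZ11 hZ00)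

/-- **FAR holds for every `q ≥ 1`.** [cite: Grimmett2006, Thm. (3.8) (p. 39); Thm. (3.21) (p. 43)] -/
theorem exchangeFarOn_of_one_le {q : ℝ} (hq : 1 ≤ q) : ExchangeFarOn V q :=
  fun w x z g 𝒰 h𝒰 _ => exchIneq_of_one_le hq w x z g 𝒰 h𝒰

/-- **STAR holds for every `q ≥ 1`.** [cite: Grimmett2006, Thm. (3.8) (p. 39); Thm. (3.21) (p. 43)] -/
theorem exchangeStarOn_of_one_le {q : ℝ} (hq : 1 ≤ q) : ExchangeStarOn V q :=
  fun w x z g 𝒰 h𝒰 _ _ => exchIneq_of_one_le hq w x z g 𝒰 h𝒰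

/-- `ExchangeFarFK q` and `ExchangeStarFK q` for `q ≥ 1`. [cite: Grimmett2006, Thm. (3.8) (p. 39)] -/
theorem exchangeFarFK_of_one_le {q : ℝ} (hq : 1 ≤ q) : ExchangeFarFK q := fun _ => exchangeFarOn_of_one_le hq

/-- `ExchangeStarFK q` for `q ≥ 1`. [cite: Grimmett2006, Thm. (3.8) (p. 39)] -/
theorem exchangeStarFK_of_one_le {q : ℝ} (hq : 1 ≤ q) : ExchangeStarFK q := fun _ => exchangeStarOn_of_one_le hq

end FK

end Summit.CriticalPhenomena.PercolationContinuityZ3.Theorems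

end
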